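import Summits.CriticalPhenomena.PercolationContinuityZ3.Theorems.SahiAECornerEnvelopePrelim

/-!
# The plane `Fin 2 → ℝ`: rectangle increments, measure-preserving shuffles, generic coordinates (preliminaries)

Support file of the Sahi cell (`prim-sahi`, typer seat, generation 22; `--supports stmt-CriticalPhenomena-4575`).
Theorems only (no definitions, no named facts, no sorries).

Tools for the planar structure theorem (`SahiAEPlaneQuadrant.lean`, `SahiAEPlane.lean`: in dimension two an
a.e.-supermodular measurable function has a Borel everywhere-supermodular version WITHOUT any boundedness):

* `Plane.supermodular_of_rect` — on `Fin 2 → ℝ`, supermodularity at every pair follows from the non-negativity of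
  all rectangle increments `ψ(s',t') − ψ(s,t') − ψ(s',t) + ψ(s,t)`, `s ≤ s'`, `t ≤ t'`;
* `Plane.measurePreserving_flip` — `(x, y) ↦ ((x₀, y₁), (y₀, x₁))` preserves `λ² ⊗ λ²`
  (`measurePreserving_piecewise_pair_volume` with `S = {0}`); `Plane.ae_rect_of_ae_supermodular` — the a.e. pair
  inequality implies the a.e. RECTANGLE inequality
  `φ(x₀∧y₀, x₁∨y₁) + φ(x₀∨y₀, x₁∧y₁) ≤ φ(x ∧ y) + φ(x ∨ y)` (for comparable pairs this is the pair inequality at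
  the flipped pair);
* generic coordinates: `Plane.ae_ae_coord_zero` / `Plane.ae_ae_coord_one` (Fubini after the shuffle
  `(x, y) ↦ (x₀, (x₁, y))`), `Plane.quasiMeasurePreserving_eval`, pull-backs `Plane.ae_pair_of_ae_coord_zero_pair`,
  `Plane.ae_pair_of_ae_coord_one_pair_swap`;
* reflections `x ↦ (x₀, −x₁)`, `(−x₀, x₁)`, `−x`: measure preserving, and the rectangle inequality of `φ` transfers
  to `−φ(x₀, −x₁)`, `−φ(−x₀, x₁)`, `φ(−x)` (`Plane.ae_rect_reflect₁/₂/₃`).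

No sorries, no new axioms.
-/

noncomputable section

namespace Summit.CriticalPhenomena.PercolationContinuityZ3.Theorems.SahiAEFourFunctions.Plane

open MeasureTheory Set Filter Topology Function
open scoped ENNReal NNReal

/-! ### Points and rectangles -/

/-- A point of the plane is the vector of its two coordinates. [folklore] -/
private theorem eta (x : Fin 2 → ℝ) : x = ![x 0, x 1] := by
  ext i; fin_cases i <;> rfl

/-- First coordinate of an explicit point. [folklore] -/
@[simp] private theorem vec_zero (s t : ℝ) : (![s, t] : Fin 2 → ℝ) 0 = s := rfl

/-- Second coordinate of an explicit point. [folklore] -/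
@[simp] private theorem vec_one (s t : ℝ) : (![s, t] : Fin 2 → ℝ) 1 = t := rfl

/-- Meet of two explicit points. [folklore] -/
theorem vec_inf_vec (s t s' t' : ℝ) : (![s, t] : Fin 2 → ℝ) ⊓ ![s', t'] = ![min s s', min t t'] := by
  ext i; fin_cases i <;> rfl

/-- Join of two explicit points. [folklore] -/
theorem vec_sup_vec (s t s' t' : ℝ) : (![s, t] : Fin 2 → ℝ) ⊔ ![s', t'] = ![max s s', max t t'] := by
  ext i; fin_cases i <;> rfl

/-- Comparison of explicit points. [folklore] -/
theorem vec_le_vec {s t s' t' : ℝ} : (![s, t] : Fin 2 → ℝ) ≤ ![s', t'] ↔ s ≤ s' ∧ t ≤ t' := by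
  constructor
  · intro h; exact ⟨h 0, h 1⟩
  · rintro ⟨h0, h1⟩ i; fin_cases i <;> assumption

/-- **From rectangle increments to supermodularity** (dimension two): if
`ψ(s,t') + ψ(s',t) ≤ ψ(s,t) + ψ(s',t')` whenever `s ≤ s'`, `t ≤ t'`, then `ψ` is supermodular at every pair.
[folklore] -/
theorem supermodular_of_rect {ψ : (Fin 2 → ℝ) → ℝ}
    (h : ∀ s s' t t' : ℝ, s ≤ s' → t ≤ t' → ψ ![s, t'] + ψ ![s', t] ≤ ψ ![s, t] + ψ ![s', t']) (x y : Fin 2 → ℝ) :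
    ψ x + ψ y ≤ ψ (x ⊓ y) + ψ (x ⊔ y) := by
  rw [eta x, eta y, vec_inf_vec, vec_sup_vec]
  rcases le_total (x 0) (y 0) with h0 | h0 <;> rcases le_total (x 1) (y 1) with h1 | h1
  · rw [min_eq_left h0, min_eq_left h1, max_eq_right h0, max_eq_right h1]
  · rw [min_eq_left h0, min_eq_right h1, max_eq_right h0, max_eq_left h1]
    linarith [h (x 0) (y 0) (y 1) (x 1) h0 h1]
  · rw [min_eq_right h0, min_eq_left h1, max_eq_left h0, max_eq_right h1]
    linarith [h (y 0) (x 0) (x 1) (y 1) h0 h1]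
  · rw [min_eq_right h0, min_eq_right h1, max_eq_left h0, max_eq_left h1]
    linarith

/-- Conversely, supermodularity at every pair gives the rectangle inequalities. [folklore] -/
theorem rect_of_supermodular {ψ : (Fin 2 → ℝ) → ℝ} (h : ∀ x y, ψ x + ψ y ≤ ψ (x ⊓ y) + ψ (x ⊔ y))
    {s s' t t' : ℝ} (hs : s ≤ s') (ht : t ≤ t') : ψ ![s, t'] + ψ ![s', t] ≤ ψ ![s, t] + ψ ![s', t'] := by
  have := h ![s, t'] ![s', t]
  rwa [vec_inf_vec, vec_sup_vec, min_eq_left hs, min_eq_right ht, max_eq_right hs, max_eq_left ht] at this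

/-! ### Measure-preserving shuffles of `(Fin 2 → ℝ) × (Fin 2 → ℝ)` -/

/-- **The flip `(x, y) ↦ ((x₀, y₁), (y₀, x₁))` preserves `λ² ⊗ λ²`.** [folklore] -/
theorem measurePreserving_flip :
    MeasurePreserving (fun p : (Fin 2 → ℝ) × (Fin 2 → ℝ) => ((![p.1 0, p.2 1] : Fin 2 → ℝ), (![p.2 0, p.1 1] : Fin 2 → ℝ)))
      ((volume : Measure (Fin 2 → ℝ)).prod volume) ((volume : Measure (Fin 2 → ℝ)).prod volume) := by
  classical
  have h := measurePreserving_piecewise_pair_volume (ι := Fin 2) ({0} : Finset (Fin 2))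
  have e : (fun p : (Fin 2 → ℝ) × (Fin 2 → ℝ) =>
      (({0} : Finset (Fin 2)).piecewise p.1 p.2, ({0} : Finset (Fin 2)).piecewise p.2 p.1)) =
      fun p => ((![p.1 0, p.2 1] : Fin 2 → ℝ), (![p.2 0, p.1 1] : Fin 2 → ℝ)) := by
    funext p
    refine Prod.ext ?_ ?_ <;> (ext i; fin_cases i <;> simp)
  rwa [e] at h

/-- The coordinate maps `x ↦ xᵢ` are quasi-measure-preserving `λ² → λ`. [folklore] -/
theorem quasiMeasurePreserving_eval (i : Fin 2) :
    Measure.QuasiMeasurePreserving (fun x : Fin 2 → ℝ => x i) (volume : Measure (Fin 2 → ℝ)) (volume : Measure ℝ) := by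
  have h := (MeasureTheory.volume_preserving_finTwoArrow ℝ).quasiMeasurePreserving
  have h0 : (fun x : Fin 2 → ℝ => x 0) = Prod.fst ∘ ⇑(MeasurableEquiv.finTwoArrow (α := ℝ)) := by
    funext x; simp
  have h1 : (fun x : Fin 2 → ℝ => x 1) = Prod.snd ∘ ⇑(MeasurableEquiv.finTwoArrow (α := ℝ)) := by
    funext x; simp
  fin_cases i
  · show Measure.QuasiMeasurePreserving (fun x : Fin 2 → ℝ => x 0) volume volume
    rw [h0]; exact Measure.quasiMeasurePreserving_fst.comp h
  · show Measure.QuasiMeasurePreserving (fun x : Fin 2 → ℝ => x 1) volume volume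
    rw [h1]; exact Measure.quasiMeasurePreserving_snd.comp h

/-- `∀ᵐ t ∂λ, P t` implies `∀ᵐ b ∂λ², P (b i)`. [folklore] -/
theorem ae_coord_of_ae {P : ℝ → Prop} (i : Fin 2) (h : ∀ᵐ t ∂(volume : Measure ℝ), P t) :
    ∀ᵐ b ∂(volume : Measure (Fin 2 → ℝ)), P (b i) :=
  (quasiMeasurePreserving_eval i).ae h

/-! ### The rectangle form of a.e. supermodularity -/

/-- **a.e. pair inequality ⟹ a.e. rectangle inequality.**  If `φ(x) + φ(y) ≤ φ(x ∧ y) + φ(x ∨ y)` for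
`λ² ⊗ λ²`-a.e. `(x, y)`, then for a.e. `(x, y)` also
`φ(x₀∧y₀, x₁∨y₁) + φ(x₀∨y₀, x₁∧y₁) ≤ φ(x ∧ y) + φ(x ∨ y)` (for an incomparable pair this is the pair inequality
itself, for a comparable pair it is the pair inequality at the flipped pair). [this work] -/
theorem ae_rect_of_ae_supermodular {φ : (Fin 2 → ℝ) → ℝ}
    (hsm : ∀ᵐ p : (Fin 2 → ℝ) × (Fin 2 → ℝ) ∂((volume : Measure (Fin 2 → ℝ)).prod volume),
      φ p.1 + φ p.2 ≤ φ (p.1 ⊓ p.2) + φ (p.1 ⊔ p.2)) :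
    ∀ᵐ p : (Fin 2 → ℝ) × (Fin 2 → ℝ) ∂((volume : Measure (Fin 2 → ℝ)).prod volume),
      φ ![min (p.1 0) (p.2 0), max (p.1 1) (p.2 1)] + φ ![max (p.1 0) (p.2 0), min (p.1 1) (p.2 1)] ≤
        φ (p.1 ⊓ p.2) + φ (p.1 ⊔ p.2) := by
  filter_upwards [hsm, measurePreserving_flip.quasiMeasurePreserving.ae hsm] with p h1 h2
  obtain ⟨x, y⟩ := p
  obtain ⟨a, c, rfl⟩ : ∃ a c : ℝ, x = ![a, c] := ⟨x 0, x 1, eta x⟩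
  obtain ⟨a', c', rfl⟩ : ∃ a' c' : ℝ, y = ![a', c'] := ⟨y 0, y 1, eta y⟩
  simp only [vec_zero, vec_one, vec_inf_vec, vec_sup_vec] at h1 h2 ⊢
  rcases le_total a a' with h0 | h0 <;> rcases le_total c c' with h1' | h1'
  · rw [min_eq_left h0, min_eq_left h1', max_eq_right h0, max_eq_right h1'] at h1 ⊢
    rw [min_eq_left h0, max_eq_right h0, min_eq_right h1', max_eq_left h1'] at h2
    linarith
  · rw [min_eq_left h0, min_eq_right h1', max_eq_right h0, max_eq_left h1'] at h1 ⊢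
    linarith
  · rw [min_eq_right h0, min_eq_left h1', max_eq_left h0, max_eq_right h1'] at h1 ⊢
    linarith
  · rw [min_eq_right h0, min_eq_right h1', max_eq_left h0, max_eq_left h1'] at h1 ⊢
    rw [min_eq_right h0, max_eq_left h0, min_eq_left h1', max_eq_right h1'] at h2
    linarith

/-- The rectangle form implies the pair form, at every point where it holds. [folklore] -/
theorem supermodular_of_rect_pointwise {φ : (Fin 2 → ℝ) → ℝ} {x y : Fin 2 → ℝ}
    (h : φ ![min (x 0) (y 0), max (x 1) (y 1)] + φ ![max (x 0) (y 0), min (x 1) (y 1)] ≤ φ (x ⊓ y) + φ (x ⊔ y)) :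
    φ x + φ y ≤ φ (x ⊓ y) + φ (x ⊔ y) := by
  revert h
  obtain ⟨a, c, rfl⟩ : ∃ a c : ℝ, x = ![a, c] := ⟨x 0, x 1, eta x⟩
  obtain ⟨a', c', rfl⟩ : ∃ a' c' : ℝ, y = ![a', c'] := ⟨y 0, y 1, eta y⟩
  intro h
  simp only [vec_zero, vec_one, vec_inf_vec, vec_sup_vec] at h ⊢
  rcases le_total a a' with h0 | h0 <;> rcases le_total c c' with h1 | h1
  · rw [min_eq_left h0, min_eq_left h1, max_eq_right h0, max_eq_right h1]
  · rw [min_eq_left h0, min_eq_right h1, max_eq_right h0, max_eq_left h1] at h ⊢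
    exact h
  · rw [min_eq_right h0, min_eq_left h1, max_eq_left h0, max_eq_right h1] at h ⊢
    linarith
  · rw [min_eq_right h0, min_eq_right h1, max_eq_left h0, max_eq_left h1]
    linarith

/-! ### Generic coordinates (Fubini after a shuffle) -/

/-- `(s, (t, y)) ↦ ((s, t), y)` preserves the measure (`λ ⊗ (λ ⊗ λ²) → λ² ⊗ λ²`). [folklore] -/
theorem measurePreserving_join :
    MeasurePreserving (fun z : ℝ × (ℝ × (Fin 2 → ℝ)) => (((![z.1, z.2.1] : Fin 2 → ℝ)), z.2.2))
      ((volume : Measure ℝ).prod ((volume : Measure ℝ).prod (volume : Measure (Fin 2 → ℝ))))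
      ((volume : Measure (Fin 2 → ℝ)).prod volume) := by
  have h1 : MeasurePreserving (Prod.map (⇑(MeasurableEquiv.finTwoArrow (α := ℝ)).symm) id)
      (((volume : Measure ℝ).prod (volume : Measure ℝ)).prod (volume : Measure (Fin 2 → ℝ)))
      ((volume : Measure (Fin 2 → ℝ)).prod volume) :=
    (MeasureTheory.volume_preserving_finTwoArrow ℝ).symm.prod (MeasurePreserving.id _)
  have h2 := (MeasureTheory.measurePreserving_prodAssoc (volume : Measure ℝ) (volume : Measure ℝ)
    (volume : Measure (Fin 2 → ℝ))).symm
  have h := h1.comp h2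
  have e : (Prod.map (⇑(MeasurableEquiv.finTwoArrow (α := ℝ)).symm) id ∘
      ⇑(MeasurableEquiv.prodAssoc : (ℝ × ℝ) × (Fin 2 → ℝ) ≃ᵐ ℝ × ℝ × (Fin 2 → ℝ)).symm) =
      fun z : ℝ × (ℝ × (Fin 2 → ℝ)) => (((![z.1, z.2.1] : Fin 2 → ℝ)), z.2.2) := by
    funext z
    refine Prod.ext ?_ rfl
    ext i
    fin_cases i <;> simp [MeasurableEquiv.prodAssoc, MeasurableEquiv.finTwoArrow]
  rwa [e] at h

/-- **Generic first coordinate.**  If `S(x, y)` holds for a.e. pair, then for a.e. `s`, `S((s, t), y)` holds for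
a.e. `(t, y)`. [folklore] -/
theorem ae_ae_coord_zero {S : (Fin 2 → ℝ) → (Fin 2 → ℝ) → Prop}
    (h : ∀ᵐ p ∂((volume : Measure (Fin 2 → ℝ)).prod volume), S p.1 p.2) :
    ∀ᵐ s ∂(volume : Measure ℝ), ∀ᵐ q ∂((volume : Measure ℝ).prod (volume : Measure (Fin 2 → ℝ))),
      S ![s, q.1] q.2 :=
  Measure.ae_ae_of_ae_prod (measurePreserving_join.quasiMeasurePreserving.ae h)

/-- The coordinate swap `x ↦ (x₁, x₀)` preserves `λ²`. [folklore] -/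
theorem measurePreserving_swapCoords :
    MeasurePreserving (fun x : Fin 2 → ℝ => (![x 1, x 0] : Fin 2 → ℝ)) (volume : Measure (Fin 2 → ℝ)) volume := by
  have h := (MeasureTheory.volume_preserving_finTwoArrow ℝ).symm.comp
    ((Measure.measurePreserving_swap (μ := (volume : Measure ℝ)) (ν := (volume : Measure ℝ))).comp
      (MeasureTheory.volume_preserving_finTwoArrow ℝ))
  have e : (⇑(MeasurableEquiv.finTwoArrow (α := ℝ)).symm ∘ (Prod.swap ∘ ⇑(MeasurableEquiv.finTwoArrow (α := ℝ)))) =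
      fun x : Fin 2 → ℝ => (![x 1, x 0] : Fin 2 → ℝ) := by
    funext x; ext i; fin_cases i <;> simp [MeasurableEquiv.finTwoArrow]
  rwa [e] at h

/-- **Generic second coordinate.**  If `S(x, y)` holds for a.e. pair, then for a.e. `t`, `S((s, t), y)` holds for
a.e. `(s, y)`. [folklore] -/
theorem ae_ae_coord_one {S : (Fin 2 → ℝ) → (Fin 2 → ℝ) → Prop}
    (h : ∀ᵐ p ∂((volume : Measure (Fin 2 → ℝ)).prod volume), S p.1 p.2) :
    ∀ᵐ t ∂(volume : Measure ℝ), ∀ᵐ q ∂((volume : Measure ℝ).prod (volume : Measure (Fin 2 → ℝ))),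
      S ![q.1, t] q.2 := by
  have h' : ∀ᵐ p ∂((volume : Measure (Fin 2 → ℝ)).prod volume), S ![p.1 1, p.1 0] p.2 :=
    (measurePreserving_swapCoords.prod (MeasurePreserving.id (volume : Measure (Fin 2 → ℝ)))).quasiMeasurePreserving.ae h
  have h'' := ae_ae_coord_zero (S := fun x v => S ![x 1, x 0] v) h'
  filter_upwards [h''] with s hs
  filter_upwards [hs] with q hq
  simpa only [vec_zero, vec_one] using hq

/-- Pull-back of a statement about `(xᵢ, y)` to pairs `(x, y)`. [folklore] -/
theorem ae_pair_of_ae_coord_pair {T : ℝ → (Fin 2 → ℝ) → Prop} (i : Fin 2)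
    (h : ∀ᵐ q ∂((volume : Measure ℝ).prod (volume : Measure (Fin 2 → ℝ))), T q.1 q.2) :
    ∀ᵐ p : (Fin 2 → ℝ) × (Fin 2 → ℝ) ∂((volume : Measure (Fin 2 → ℝ)).prod volume), T (p.1 i) p.2 :=
  (MeasureTheory.QuasiMeasurePreserving.prodMap (quasiMeasurePreserving_eval i)
    (Measure.QuasiMeasurePreserving.id (volume : Measure (Fin 2 → ℝ)))).ae h

/-- Pull-back of a statement about `(yᵢ, x)` to pairs `(x, y)`. [folklore] -/
theorem ae_pair_of_ae_coord_pair_swap {T : ℝ → (Fin 2 → ℝ) → Prop} (i : Fin 2)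
    (h : ∀ᵐ q ∂((volume : Measure ℝ).prod (volume : Measure (Fin 2 → ℝ))), T q.1 q.2) :
    ∀ᵐ p : (Fin 2 → ℝ) × (Fin 2 → ℝ) ∂((volume : Measure (Fin 2 → ℝ)).prod volume), T (p.2 i) p.1 :=
  (Measure.measurePreserving_swap (μ := (volume : Measure (Fin 2 → ℝ)))
    (ν := (volume : Measure (Fin 2 → ℝ)))).quasiMeasurePreserving.ae (ae_pair_of_ae_coord_pair i h)

/-! ### Reflections -/

/-- `x ↦ (x₀, −x₁)` preserves `λ²`. [folklore] -/
theorem measurePreserving_reflect₁ :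
    MeasurePreserving (fun x : Fin 2 → ℝ => (![x 0, -x 1] : Fin 2 → ℝ)) (volume : Measure (Fin 2 → ℝ)) volume := by
  have h := (MeasureTheory.volume_preserving_finTwoArrow ℝ).symm.comp
    (((MeasurePreserving.id (volume : Measure ℝ)).prod (Measure.measurePreserving_neg (volume : Measure ℝ))).comp
      (MeasureTheory.volume_preserving_finTwoArrow ℝ))
  have e : (⇑(MeasurableEquiv.finTwoArrow (α := ℝ)).symm ∘ (Prod.map id Neg.neg ∘ ⇑(MeasurableEquiv.finTwoArrow (α := ℝ)))) =
      fun x : Fin 2 → ℝ => (![x 0, -x 1] : Fin 2 → ℝ) := by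
    funext x; ext i; fin_cases i <;> simp [MeasurableEquiv.finTwoArrow]
  rwa [e] at h

/-- `x ↦ (−x₀, x₁)` preserves `λ²`. [folklore] -/
theorem measurePreserving_reflect₂ :
    MeasurePreserving (fun x : Fin 2 → ℝ => (![-x 0, x 1] : Fin 2 → ℝ)) (volume : Measure (Fin 2 → ℝ)) volume := by
  have h := (MeasureTheory.volume_preserving_finTwoArrow ℝ).symm.comp
    (((Measure.measurePreserving_neg (volume : Measure ℝ)).prod (MeasurePreserving.id (volume : Measure ℝ))).comp
      (MeasureTheory.volume_preserving_finTwoArrow ℝ))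
  have e : (⇑(MeasurableEquiv.finTwoArrow (α := ℝ)).symm ∘ (Prod.map Neg.neg id ∘ ⇑(MeasurableEquiv.finTwoArrow (α := ℝ)))) =
      fun x : Fin 2 → ℝ => (![-x 0, x 1] : Fin 2 → ℝ) := by
    funext x; ext i; fin_cases i <;> simp [MeasurableEquiv.finTwoArrow]
  rwa [e] at h

/-- `x ↦ (−x₀, −x₁)` preserves `λ²`. [folklore] -/
theorem measurePreserving_reflect₃ :
    MeasurePreserving (fun x : Fin 2 → ℝ => (![-x 0, -x 1] : Fin 2 → ℝ)) (volume : Measure (Fin 2 → ℝ)) volume := by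
  have h := (MeasureTheory.volume_preserving_finTwoArrow ℝ).symm.comp
    (((Measure.measurePreserving_neg (volume : Measure ℝ)).prod (Measure.measurePreserving_neg (volume : Measure ℝ))).comp
      (MeasureTheory.volume_preserving_finTwoArrow ℝ))
  have e : (⇑(MeasurableEquiv.finTwoArrow (α := ℝ)).symm ∘ (Prod.map Neg.neg Neg.neg ∘ ⇑(MeasurableEquiv.finTwoArrow (α := ℝ)))) =
      fun x : Fin 2 → ℝ => (![-x 0, -x 1] : Fin 2 → ℝ) := by
    funext x; ext i; fin_cases i <;> simp [MeasurableEquiv.finTwoArrow]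
  rwa [e] at h

/-- Rectangle inequality a.e. for `φ` ⟹ for `x ↦ −φ(x₀, −x₁)`. [this work] -/
theorem ae_rect_reflect₁ {φ : (Fin 2 → ℝ) → ℝ}
    (h : ∀ᵐ p : (Fin 2 → ℝ) × (Fin 2 → ℝ) ∂((volume : Measure (Fin 2 → ℝ)).prod volume),
      φ ![min (p.1 0) (p.2 0), max (p.1 1) (p.2 1)] + φ ![max (p.1 0) (p.2 0), min (p.1 1) (p.2 1)] ≤
        φ (p.1 ⊓ p.2) + φ (p.1 ⊔ p.2)) :
    ∀ᵐ p : (Fin 2 → ℝ) × (Fin 2 → ℝ) ∂((volume : Measure (Fin 2 → ℝ)).prod volume),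
      (fun x : Fin 2 → ℝ => -φ ![x 0, -x 1]) ![min (p.1 0) (p.2 0), max (p.1 1) (p.2 1)] +
          (fun x : Fin 2 → ℝ => -φ ![x 0, -x 1]) ![max (p.1 0) (p.2 0), min (p.1 1) (p.2 1)] ≤
        (fun x : Fin 2 → ℝ => -φ ![x 0, -x 1]) (p.1 ⊓ p.2) + (fun x : Fin 2 → ℝ => -φ ![x 0, -x 1]) (p.1 ⊔ p.2) := by
  have h' := (measurePreserving_reflect₁.prod measurePreserving_reflect₁).quasiMeasurePreserving.ae h
  filter_upwards [h'] with p hp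
  obtain ⟨x, y⟩ := p
  obtain ⟨a, c, rfl⟩ : ∃ a c : ℝ, x = ![a, c] := ⟨x 0, x 1, eta x⟩
  obtain ⟨a', c', rfl⟩ : ∃ a' c' : ℝ, y = ![a', c'] := ⟨y 0, y 1, eta y⟩
  simp only [Prod.map_apply, vec_zero, vec_one, vec_inf_vec, vec_sup_vec, max_neg_neg, min_neg_neg] at hp ⊢
  linarith

/-- Rectangle inequality a.e. for `φ` ⟹ for `x ↦ −φ(−x₀, x₁)`. [this work] -/
theorem ae_rect_reflect₂ {φ : (Fin 2 → ℝ) → ℝ}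
    (h : ∀ᵐ p : (Fin 2 → ℝ) × (Fin 2 → ℝ) ∂((volume : Measure (Fin 2 → ℝ)).prod volume),
      φ ![min (p.1 0) (p.2 0), max (p.1 1) (p.2 1)] + φ ![max (p.1 0) (p.2 0), min (p.1 1) (p.2 1)] ≤
        φ (p.1 ⊓ p.2) + φ (p.1 ⊔ p.2)) :
    ∀ᵐ p : (Fin 2 → ℝ) × (Fin 2 → ℝ) ∂((volume : Measure (Fin 2 → ℝ)).prod volume),
      (fun x : Fin 2 → ℝ => -φ ![-x 0, x 1]) ![min (p.1 0) (p.2 0), max (p.1 1) (p.2 1)] +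
          (fun x : Fin 2 → ℝ => -φ ![-x 0, x 1]) ![max (p.1 0) (p.2 0), min (p.1 1) (p.2 1)] ≤
        (fun x : Fin 2 → ℝ => -φ ![-x 0, x 1]) (p.1 ⊓ p.2) + (fun x : Fin 2 → ℝ => -φ ![-x 0, x 1]) (p.1 ⊔ p.2) := by
  have h' := (measurePreserving_reflect₂.prod measurePreserving_reflect₂).quasiMeasurePreserving.ae h
  filter_upwards [h'] with p hp
  obtain ⟨x, y⟩ := p
  obtain ⟨a, c, rfl⟩ : ∃ a c : ℝ, x = ![a, c] := ⟨x 0, x 1, eta x⟩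
  obtain ⟨a', c', rfl⟩ : ∃ a' c' : ℝ, y = ![a', c'] := ⟨y 0, y 1, eta y⟩
  simp only [Prod.map_apply, vec_zero, vec_one, vec_inf_vec, vec_sup_vec, max_neg_neg, min_neg_neg] at hp ⊢
  linarith

/-- Rectangle inequality a.e. for `φ` ⟹ for `x ↦ φ(−x₀, −x₁)`. [this work] -/
theorem ae_rect_reflect₃ {φ : (Fin 2 → ℝ) → ℝ}
    (h : ∀ᵐ p : (Fin 2 → ℝ) × (Fin 2 → ℝ) ∂((volume : Measure (Fin 2 → ℝ)).prod volume),
      φ ![min (p.1 0) (p.2 0), max (p.1 1) (p.2 1)] + φ ![max (p.1 0) (p.2 0), min (p.1 1) (p.2 1)] ≤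
        φ (p.1 ⊓ p.2) + φ (p.1 ⊔ p.2)) :
    ∀ᵐ p : (Fin 2 → ℝ) × (Fin 2 → ℝ) ∂((volume : Measure (Fin 2 → ℝ)).prod volume),
      (fun x : Fin 2 → ℝ => φ ![-x 0, -x 1]) ![min (p.1 0) (p.2 0), max (p.1 1) (p.2 1)] +
          (fun x : Fin 2 → ℝ => φ ![-x 0, -x 1]) ![max (p.1 0) (p.2 0), min (p.1 1) (p.2 1)] ≤
        (fun x : Fin 2 → ℝ => φ ![-x 0, -x 1]) (p.1 ⊓ p.2) + (fun x : Fin 2 → ℝ => φ ![-x 0, -x 1]) (p.1 ⊔ p.2) := by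
  have h' := (measurePreserving_reflect₃.prod measurePreserving_reflect₃).quasiMeasurePreserving.ae h
  filter_upwards [h'] with p hp
  obtain ⟨x, y⟩ := p
  obtain ⟨a, c, rfl⟩ : ∃ a c : ℝ, x = ![a, c] := ⟨x 0, x 1, eta x⟩
  obtain ⟨a', c', rfl⟩ : ∃ a' c' : ℝ, y = ![a', c'] := ⟨y 0, y 1, eta y⟩
  simp only [Prod.map_apply, vec_zero, vec_one, vec_inf_vec, vec_sup_vec, max_neg_neg, min_neg_neg] at hp ⊢
  linarith

end Summit.CriticalPhenomena.PercolationContinuityZ3.Theorems.SahiAEFourFunctions.Plane
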